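import Literature.Topology.FourManifolds.TrisectionsExistenceUnbalanced
import Literature.Topology.FourManifolds.TrisectionsImplantFaces
import Literature.Topology.FourManifolds.TrisectionsStabilizationNF
import Literature.Topology.FourManifolds.TrisectionsSectorClauses
import Literature.Topology.FourManifolds.TrisectionsTriNormalForm
import Literature.Topology.FourManifolds.TrisectionsFaceFromGK
import Literature.Topology.FourManifolds.TrisectionFunctorGKCentralSurface
import HarnessLib

/-!
# Gay–Kirby 2016, Thm. 4 (existence of balanced trisections), proved

Topic `Literature/Topology/FourManifolds`; the discharge of the named fact
`Literature.Topology.FourManifolds.exists_isBalancedGKTrisection` of `Trisections.lean` for the fact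
seat `provefact-Literature.Topology.FourManifolds.exists_isBalancedGKTrisection` (Gay–Kirby 2016,
Thm. 4).  Everything in this file is **proved**; no definitions, no named facts.

The construction of §4, Lemma 14 (`exists_isGKTrisection`, `TrisectionsExistenceUnbalanced.lean`)
gives every closed connected smooth `4`-manifold a `(g; k₁, k₂, k₁)`-trisection with corners
along the central surface, `k₁ ≤ k₂ ≤ g`.  Balance is restored by Gay–Kirby's own move
(§4, p. 14: *"add cancelling `1`–`2` pairs"*, i.e. raise `k₁` and `k₃`), performed here on the
trisection rather than on the handle decomposition: **one implant** of the tree's geometric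
stabilisation (`TriNormalForm.exists_implantF`, `TrisectionsImplantFaces.lean` — one third of the
stabilisation of Def. 8 / Lemma 10, `IsGKTrisection.exists_stabilization` of
`TrisectionsStabilization.lean`, whose proof is followed here with one implant instead of three; in
Meier–Schirmer–Zupan's terminology the `i`-stabilisation, Def. 3.7 of arXiv:1507.06561:
"the `1`–stabilization of `𝒯` is a `(g+1; k₁+1, k₂, k₃)` trisection") raises the genus and one
`k_i` by one (`IsGKTrisection.exists_stabilizeOne`); `k₂ - k₁` implants on the first sector and
`k₂ - k₁` on the third give a balanced `(g + 2(k₂ - k₁), k₂)`-trisection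
(`exists_isBalancedGKTrisection_holds`).

## References

* D. Gay, R. Kirby, *Trisecting 4-manifolds*, Geom. Topol. 20 (2016) 3097–3132
  (arXiv:1205.1565): Def. 1, Def. 8, Lemma 10, §4 (Lemmas 13–14, proof of Thm. 4, p. 14),
  Thm. 4. [GayKirby2016]
* J. Meier, T. Schirmer, A. Zupan, *Classification of trisections and the Generalized Property R
  Conjecture*, Proc. AMS 144 (2016) (arXiv:1507.06561), Def. 3.7. [MeierSchirmerZupan2016]
-/

open scoped Manifold ContDiff Topology
open Set Function Filter

noncomputable section

namespace Literature.Topology.FourManifolds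

universe u

section StabilizeOne

variable {X : Type u} [TopologicalSpace X] [T2Space X] [CompactSpace X]
  [ChartedSpace (EuclideanSpace ℝ (Fin 4)) X] [IsManifold (𝓡 4) ∞ X]

/-- **One implant (the `i`-stabilisation): `(g; k) ↦ (g + 1; k + [· = i])`.**  Put the
trisection in normal form with the sector `i` first (`IsGKTrisection.exists_triNormalForm`,
`IsGKTrisection.faceNormalForms`), perform one implant (`TriNormalForm.exists_implantF`: one
more critical point of index `1` on the sector `i` and on each face), and recognise the result
(`isGKTrisection_of_triNormalForm`, `FaceNormalForm.face_clause`).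
[cite: GayKirby2016, Def. 8, Lemma 10 and its proof] [cite: MeierSchirmerZupan2016, Def. 3.7] -/
theorem IsGKTrisection.exists_stabilizeOne {g : ℕ} {k : Fin 3 → ℕ} {S : Fin 3 → Set X}
    (h : IsGKTrisection X g k S) (hne : (⋂ m, S m).Nonempty) (i : Fin 3) :
    ∃ S' : Fin 3 → Set X, IsGKTrisection X (g + 1) (Function.update k i (k i + 1)) S' ∧
      (⋂ m, S' m).Nonempty := by
  -- the other two indices
  have hij : i ≠ i + 1 := by fin_cases i <;> decide
  have hjl : i + 1 ≠ i + 2 := by fin_cases i <;> decide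
  have hil : i ≠ i + 2 := by fin_cases i <;> decide
  -- normal form with faces, the sector `i` first
  obtain ⟨u, v, U, O, ρ, hT⟩ := h.exists_triNormalForm hij hjl hil
  obtain ⟨hQ₁, hQ₂, hQ₃⟩ := h.faceNormalForms hT
  -- one implant, keeping a second point of the central surface
  obtain ⟨x, hx⟩ := hne
  obtain ⟨x₁, hx₁, hx₁x⟩ := hT.sector_i.exists_ne_mem hx
  obtain ⟨S₁, u₁, v₁, ρ₁, O₁, hT₁, hSagree, -, hF₁, hF₂, hF₃⟩ :=
    hT.exists_implantF hQ₁ hQ₂ hQ₃ hx (isClosed_singleton (x := x₁)).isOpen_compl (fun h' => hx₁x h'.symm)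
  have hne₁ : (⋂ m, S₁ m).Nonempty :=
    ⟨x₁, mem_iInter.2 fun m => (hSagree m x₁ (fun h' => h' rfl)).2 (mem_iInter.1 hx₁ m)⟩
  -- the counts
  have hcnt : Function.update (fun m => handleCount 1 (k m)) i (fun n => handleCount 1 (k i) n + if n = 1 then 1 else 0) =
      fun m => handleCount 1 (Function.update k i (k i + 1) m) := by
    funext m
    by_cases hm : m = i
    · subst hm
      rw [Function.update_self, Function.update_self, handleCount_add_indicator_one]
    · rw [Function.update_of_ne hm, Function.update_of_ne hm]
  rw [hcnt] at hT₁
  rw [handleCount_add_indicator_one g] at hF₁ hF₂ hF₃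
  refine ⟨S₁, isGKTrisection_of_triNormalForm hT₁ fun a b hab => ?_, hne₁⟩
  -- the face clause for all ordered pairs
  have key : ∀ {a b : Fin 3} {nrm col : X → ℝ},
      FaceNormalForm (S₁ a ∩ S₁ b) (⋂ m, S₁ m) nrm col U (handleCount 1 (g + 1)) →
      ∀ a' b', S₁ a' ∩ S₁ b' = S₁ a ∩ S₁ b →
      ∃ (H : Type u) (_ : TopologicalSpace H) (_ : ChartedSpace (EuclideanHalfSpace 3) H) (h : H → X),
        IsManifold (𝓡∂ 3) ∞ H ∧ CompactSpace H ∧ ConnectedSpace H ∧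
          HasHandleDecomposition 2 H (handleCount 1 (g + 1)) ∧
          Manifold.IsSmoothEmbedding (𝓡∂ 3) (𝓡 4) ∞ h ∧ range h = S₁ a' ∩ S₁ b' ∧
          h '' (𝓡∂ 3).boundary H = ⋂ m, S₁ m := by
    intro a b nrm col hQ a' b' heq
    obtain ⟨H, _, _, hmap, hM, hc, hconn, hHD, hemb, hrange, hbd⟩ := hQ.face_clause
    exact ⟨H, _, _, hmap, hM, hc, hconn, hHD, hemb, by rw [heq]; exact hrange, hbd⟩
  rcases hT.eq_or a with rfl | rfl | rfl <;> rcases hT.eq_or b with rfl | hb | hb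
  · exact absurd rfl hab
  · subst hb; exact key hF₁ _ _ rfl
  · subst hb; exact key hF₃ _ _ (inter_comm _ _)
  · exact key hF₁ _ _ (inter_comm _ _)
  · subst hb; exact absurd rfl hab
  · subst hb; exact key hF₂ _ _ rfl
  · exact key hF₃ _ _ rfl
  · subst hb; exact key hF₂ _ _ (inter_comm _ _)
  · subst hb; exact absurd rfl hab

/-- **`d` implants on the sector `i`: `(g; k) ↦ (g + d; k + d [· = i])`.**
[cite: GayKirby2016, Def. 8, Lemma 10] [cite: MeierSchirmerZupan2016, Def. 3.7] -/
theorem IsGKTrisection.exists_stabilizeOne_iter {g : ℕ} {k : Fin 3 → ℕ} {S : Fin 3 → Set X}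
    (h : IsGKTrisection X g k S) (hne : (⋂ m, S m).Nonempty) (i : Fin 3) (d : ℕ) :
    ∃ S' : Fin 3 → Set X, IsGKTrisection X (g + d) (Function.update k i (k i + d)) S' ∧
      (⋂ m, S' m).Nonempty := by
  induction d with
  | zero => exact ⟨S, by rw [add_zero, add_zero, Function.update_eq_self]; exact h, hne⟩
  | succ d ih =>
    obtain ⟨S', h', hne'⟩ := ih
    obtain ⟨S'', h'', hne''⟩ := h'.exists_stabilizeOne hne' i
    refine ⟨S'', ?_, hne''⟩
    have hk : Function.update (Function.update k i (k i + d)) i (Function.update k i (k i + d) i + 1) =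
        Function.update k i (k i + (d + 1)) := by
      rw [Function.update_idem, Function.update_self, add_assoc]
    rw [hk] at h''
    exact h''

end StabilizeOne

/-- **Gay–Kirby 2016, Thm. 4 (existence): every closed connected oriented smooth `4`-manifold
admits a balanced `(g, k)`-trisection with corners along the central surface, `0 ≤ k ≤ g`.**
The `(g; k₁, k₂, k₁)`-trisection of `exists_isGKTrisection` (`k₁ ≤ k₂ ≤ g`; §4, Lemma 14) is
balanced by `k₂ - k₁` implants on the first sector and `k₂ - k₁` on the third (§4, p. 14, in the
form of Def. 8 / Lemma 10 one sector at a time). [cite: GayKirby2016, Thm. 4; §4, Lemmas 13–14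
and p. 14; Def. 8, Lemma 10] -/
theorem exists_isBalancedGKTrisection_holds : exists_isBalancedGKTrisection := by
  intro X _ _ _ _ _ _ _ _
  obtain ⟨g, k₁, k₂, S, h12, h2g, hT⟩ := exists_isGKTrisection X
  have hne : (⋂ m, S m).Nonempty := hT.nonempty_iInter
  obtain ⟨S₁, hT₁, hne₁⟩ := hT.exists_stabilizeOne_iter hne 0 (k₂ - k₁)
  obtain ⟨S₂, hT₂, -⟩ := hT₁.exists_stabilizeOne_iter hne₁ 2 (k₂ - k₁)
  refine ⟨g + (k₂ - k₁) + (k₂ - k₁), k₂, S₂, by omega, ?_⟩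
  have hk : Function.update (Function.update ![k₁, k₂, k₁] 0 ((![k₁, k₂, k₁] : Fin 3 → ℕ) 0 + (k₂ - k₁))) 2
      (Function.update ![k₁, k₂, k₁] 0 ((![k₁, k₂, k₁] : Fin 3 → ℕ) 0 + (k₂ - k₁)) 2 + (k₂ - k₁)) =
      fun _ => k₂ := by
    funext m
    fin_cases m <;> simp <;> omega
  unfold IsBalancedGKTrisection
  rw [← hk]
  exact hT₂

end Literature.Topology.FourManifolds

end
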